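import Mathlib
import Literature.Analysis.FluidPDE.SelfSimilar
import Literature.Analysis.FluidPDE.VectorCalculus
import Literature.Analysis.FluidPDE.SpaceTimeRescaling
import Literature.Analysis.FluidPDE.LeraySelfSimilarCalculus

/-!
# Crux `LandauTail.LandauTailBlowup` (stmt-NavierStokesRegularity-1944), line `registered`:
  stub `landauTail_rescaled_dissipation_eq` (W6) — parabolic scaling of the local dissipation

Helper file on the proof path of the crux item `stmt-NavierStokesRegularity-1944`
(`Summit.NavierStokesRegularity.NavierStokesRegularity.Theses.LandauTail.LandauTailBlowup`): the
scaling bookkeeping for the line's core-radius theorem in dissipation form.  For every space–time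
field `u : ℝ → ℝ³ → ℝ³`, every `λ > 0` and all `R, s₁, s₂`,

  `∫_{s₁}^{s₂} ∫_{B_R} |∇(u_λ)(t, x)|² dx dt = λ⁻¹ ∫_{λ²s₁}^{λ²s₂} ∫_{B_{λR}} |∇u(t, x)|² dx dt`,

where `u_λ(t, x) = λ u(λ²t, λx)` is the Navier–Stokes rescaling (`nsRescale`) and `|·|²` the squared
Frobenius norm of the spatial Fréchet derivative (lower Lebesgue integrals, no measurability or
differentiability assumptions: both sides use Mathlib's junk-value convention for `fderiv`).
Proof: the chain rule for dilations `∇(u_λ)(t, ·)(x) = λ² ∇u(λ²t, ·)(λx)`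
(`fderiv_smul_comp_smul`, valid without differentiability), so `|∇u_λ|² = λ⁴ |∇u|² ∘ Φ` with
`Φ(t, x) = (λ²t, λx)`; and the space–time substitution `Φ` (Jacobian `λ² · λ³ = λ⁵`,
`setLIntegral_frobeniusNormSq_stRescale`) maps `(s₁, s₂) × B_R` onto `(λ²s₁, λ²s₂) × B_{λR}`;
`λ⁴ · λ⁻⁵ = λ⁻¹`.

References: Caffarelli–Kohn–Nirenberg 1982, (1.5)–(1.6) (scaling of local solutions and of the
dissipation `E(r)`); Leray 1934, §20.
-/

set_option linter.dupNamespace false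

noncomputable section

open Filter Set Topology MeasureTheory Metric Function
open scoped ENNReal NNReal
open Literature.Analysis.FluidPDE

namespace Summit.NavierStokesRegularity.NavierStokesRegularity.Theorems

/-- **The gradient of the parabolic rescaling** (chain rule for dilations, no differentiability
needed): `∇(nsRescale λ u)(t, ·)(x) = λ² • ∇u(λ²t, ·)(λx)`, i.e. the space–time field
`(t, x) ↦ ∇(nsRescale λ u t)(x)` is `λ² • stPull (λ²) λ 0 0 (∇u)`. [folklore] -/
theorem landauTail_rescaledDissipation_fderiv_nsRescale (lam : ℝ)
    (u : ℝ → EuclideanSpace ℝ (Fin 3) → EuclideanSpace ℝ (Fin 3)) (z : ℝ × EuclideanSpace ℝ (Fin 3)) :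
    fderiv ℝ (nsRescale lam u z.1) z.2 =
      ((lam ^ 2) • stPull (lam ^ 2) lam 0 (0 : EuclideanSpace ℝ (Fin 3))
        (fun t x => fderiv ℝ (u t) x)) z.1 z.2 := by
  obtain ⟨t, x⟩ := z
  simp only [Pi.smul_apply, stPull_apply, zero_add]
  exact fderiv_smul_comp_smul (u (lam ^ 2 * t)) lam x

/-- **Preimage of the physical cylinder under the parabolic dilation**: for `λ > 0`,
`Φ⁻¹((λ²s₁, λ²s₂) × B_{λR}) = (s₁, s₂) × B_R` with `Φ(t, x) = (λ²t, λx)`. [folklore] -/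
theorem landauTail_rescaledDissipation_preimage {lam : ℝ} (hlam : 0 < lam) (R s₁ s₂ : ℝ) :
    stAffine (lam ^ 2) lam 0 (0 : EuclideanSpace ℝ (Fin 3)) ⁻¹'
        (Ioo (lam ^ 2 * s₁) (lam ^ 2 * s₂) ×ˢ ball (0 : EuclideanSpace ℝ (Fin 3)) (lam * R)) =
      Ioo s₁ s₂ ×ˢ ball (0 : EuclideanSpace ℝ (Fin 3)) R := by
  have hlam2 : 0 < lam ^ 2 := pow_pos hlam 2
  ext ⟨τ, y⟩
  simp only [mem_preimage, stAffine_apply, zero_add, mem_prod, mem_Ioo, mem_ball, dist_zero_right,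
    norm_smul, Real.norm_eq_abs, abs_of_pos hlam]
  constructor
  · rintro ⟨⟨h1, h2⟩, h3⟩
    exact ⟨⟨lt_of_mul_lt_mul_left h1 hlam2.le, lt_of_mul_lt_mul_left h2 hlam2.le⟩,
      lt_of_mul_lt_mul_left h3 hlam.le⟩
  · rintro ⟨⟨h1, h2⟩, h3⟩
    exact ⟨⟨mul_lt_mul_of_pos_left h1 hlam2, mul_lt_mul_of_pos_left h2 hlam2⟩,
      mul_lt_mul_of_pos_left h3 hlam⟩

/-- **Parabolic scaling of the local dissipation** (registered support stub W6 of crux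
stmt-NavierStokesRegularity-1944): for every `u : ℝ → ℝ³ → ℝ³`, `λ > 0` and all `R, s₁, s₂`,
`∫_{(s₁,s₂)×B_R} |∇(nsRescale λ u)|² = λ⁻¹ ∫_{(λ²s₁,λ²s₂)×B_{λR}} |∇u|²` (lower integrals of the
squared Frobenius norm; chain rule `λ⁴` against Jacobian `λ⁵`; Caffarelli–Kohn–Nirenberg 1982,
(1.5)–(1.6)). [folklore] -/
theorem landauTail_rescaled_dissipation_eq : ∀ (u : ℝ → EuclideanSpace ℝ (Fin 3) → EuclideanSpace ℝ (Fin 3)) (lam : ℝ), 0 < lam → ∀ R s₁ s₂ : ℝ, ∫⁻ z in Set.Ioo s₁ s₂ ×ˢ Metric.ball (0 : EuclideanSpace ℝ (Fin 3)) R, ENNReal.ofReal (Literature.Analysis.FluidPDE.frobeniusNormSq (fderiv ℝ (Literature.Analysis.FluidPDE.nsRescale lam u z.1) z.2)) = ENNReal.ofReal lam⁻¹ * ∫⁻ z in Set.Ioo (lam ^ 2 * s₁) (lam ^ 2 * s₂) ×ˢ Metric.ball (0 : EuclideanSpace ℝ (Fin 3)) (lam * R), ENNReal.ofReal (Literature.Analysis.FluidPDE.frobeniusNormSq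 (fderiv ℝ (u z.1) z.2)) := by
  intro u lam hlam R s₁ s₂
  have hlam2 : 0 < lam ^ 2 := pow_pos hlam 2
  calc ∫⁻ z in Ioo s₁ s₂ ×ˢ ball (0 : EuclideanSpace ℝ (Fin 3)) R,
        ENNReal.ofReal (frobeniusNormSq (fderiv ℝ (nsRescale lam u z.1) z.2))
      = ∫⁻ z in stAffine (lam ^ 2) lam 0 (0 : EuclideanSpace ℝ (Fin 3)) ⁻¹'
            (Ioo (lam ^ 2 * s₁) (lam ^ 2 * s₂) ×ˢ ball (0 : EuclideanSpace ℝ (Fin 3)) (lam * R)),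
          ENNReal.ofReal (frobeniusNormSq (((lam ^ 2) • stPull (lam ^ 2) lam 0
            (0 : EuclideanSpace ℝ (Fin 3)) (fun t x => fderiv ℝ (u t) x)) z.1 z.2)) := by
        rw [landauTail_rescaledDissipation_preimage hlam]
        exact lintegral_congr fun z => by rw [landauTail_rescaledDissipation_fderiv_nsRescale]
    _ = ENNReal.ofReal ((lam ^ 2) ^ 2) *
          ENNReal.ofReal (lam ^ 2 * lam ^ Module.finrank ℝ (EuclideanSpace ℝ (Fin 3)))⁻¹ *
          ∫⁻ z in Ioo (lam ^ 2 * s₁) (lam ^ 2 * s₂) ×ˢ ball (0 : EuclideanSpace ℝ (Fin 3)) (lam * R),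
            ENNReal.ofReal (frobeniusNormSq ((fun t x => fderiv ℝ (u t) x) z.1 z.2)) :=
        setLIntegral_frobeniusNormSq_stRescale hlam2 hlam 0 (0 : EuclideanSpace ℝ (Fin 3)) (lam ^ 2)
          (fun t x => fderiv ℝ (u t) x) _
    _ = ENNReal.ofReal lam⁻¹ *
          ∫⁻ z in Ioo (lam ^ 2 * s₁) (lam ^ 2 * s₂) ×ˢ ball (0 : EuclideanSpace ℝ (Fin 3)) (lam * R),
            ENNReal.ofReal (frobeniusNormSq (fderiv ℝ (u z.1) z.2)) := by
        rw [finrank_euclideanSpace_fin, ← ENNReal.ofReal_mul (by positivity)]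
        congr 2
        field_simp

end Summit.NavierStokesRegularity.NavierStokesRegularity.Theorems

end
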